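import Summits.CriticalPhenomena.Ising3DConformalLimit.Theorems.PerfectScreeningGaussianLimitNotScreenedRegressionDefs
import Literature.Probability.LatticeModels.GKSInequalities
import HarnessLib

/-!
# Crux `GaussianLimitNotScreened` (stmt-CriticalPhenomena-13886, route PerfectScreening r4), line
# `single-layer-linear-regression`: the Markov and mirror structure of the Boltzmann weight of `[-L,L]³`
# across the layer `{x₀ = 0}` (helper file 1/2 of stub M1 `stub_markovSquare` — THEOREM-ONLY)

Everything here is finite-volume and exact. For the nearest-neighbour Ising model in the box
`Λ = [-L,L]³` with plus boundary condition (tree `isingWeight`, `glue`, `edgesTouching`) and the layer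
`{y ∈ ℤ³ | y₀ = 0}`:

* §A mirrors `θ` of `ℤ³` through the layer (`θ x = (−x₀, x₁, x₂)`, e.g. the signed coordinate
  permutation `Site.signedPerm 1 (−1, 1, 1)`): they fix the layer pointwise, are involutions and map
  `(−n,0,0)` to the deep site `(n,0,0)`; no bond of `ℤ³` joins `{x₀ > 0}` to `{x₀ < 0}` (`adj_halfSpaces`);
* §B the half-space MIX `mix τ τ' : y ↦ (0 ≤ y₀ ? τ y : τ' y)` of two finite configurations: glued with the
  plus boundary condition it restricts to `τ` on the closed upper and — for `τ, τ'` with the same layer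
  spins — to `τ'` on the closed lower half-space; hence the **Markov property**
  `H(mix τ τ') + H(mix τ' τ) = H(τ) + H(τ')`, i.e. `w(mix τ τ')·w(mix τ' τ) = w(τ)·w(τ')`
  (`weight_mix_mul`): conditionally on the layer spins the two half-configurations are independent;
* §C the mirror acting on finite configurations by relabelling (`volEquiv`): it fixes layer spins, is an
  involution, preserves the Boltzmann weight (`isingHamiltonian_comp`) and turns `σ_{(−n,0,0)}` into
  `σ_{(n,0,0)}`;
* §D the registered bookkeeping theorem `stub_markovSquareMixing` packaging §B–§C as the existence of a
  pair `(Θ, mix)` with the nine identities consumed by the fibre-sum algebra of helper file 2/2.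

References: J. Glimm, A. Jaffe, *Quantum Physics* (2nd ed., 1987), §6.1, Remark "Transfer matrix of
statistical physics", pp. 89–90 [GlimmJaffe1987]; S. Friedli, Y. Velenik, *Statistical Mechanics of
Lattice Systems* (2017), §3.1 and Exercise 3.14 [FriedliVelenik2017].
-/

noncomputable section

namespace Summit.CriticalPhenomena.Ising3DConformalLimit.Cruxes.GaussianLimitNotScreened.SingleLayerLinearRegression

open Literature.Probability.LatticeModels

/-! ### §A. Mirrors of `ℤ³` through the layer -/

/-- A bijection of `ℤ³` negating the height and fixing the transverse coordinates (a *mirror through the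
layer*) fixes the layer `{x₀ = 0}` pointwise. [folklore] -/
theorem mirror_of_layer (θ : Site 3 ≃ Site 3) (hθ0 : ∀ p, θ p 0 = -p 0)
    (hθ1 : ∀ p (i : Fin 3), i ≠ 0 → θ p i = p i) {p : Site 3} (hp : p 0 = 0) : θ p = p := by
  funext i
  by_cases hi : i = 0
  · subst hi; rw [hθ0, hp, neg_zero]
  · exact hθ1 p i hi

/-- A mirror through the layer is an involution. [folklore] -/
theorem mirror_mirror (θ : Site 3 ≃ Site 3) (hθ0 : ∀ p, θ p 0 = -p 0)
    (hθ1 : ∀ p (i : Fin 3), i ≠ 0 → θ p i = p i) (p : Site 3) : θ (θ p) = p := by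
  funext i
  by_cases hi : i = 0
  · subst hi; rw [hθ0, hθ0, neg_neg]
  · rw [hθ1 _ i hi, hθ1 _ i hi]

/-- The mirror image of `(-n, 0, 0)` is the deep site `(n, 0, 0)`. [folklore] -/
theorem mirror_negDeep (θ : Site 3 ≃ Site 3) (hθ0 : ∀ p, θ p 0 = -p 0)
    (hθ1 : ∀ p (i : Fin 3), i ≠ 0 → θ p i = p i) (n : ℕ) :
    θ (Fin.cons (-(n : ℤ)) 0 : Site 3) = deepSite n := by
  funext i
  by_cases hi : i = 0
  · subst hi; rw [hθ0]; simp [deepSite]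
  · rw [hθ1 _ i hi]
    obtain ⟨j, rfl⟩ := Fin.exists_succ_eq.2 hi
    simp [deepSite]

/-- The signed coordinate permutation `x ↦ (−x₀, x₁, x₂)` negates the height coordinate. [folklore] -/
theorem signedPerm_mirror_apply_zero (p : Site 3) :
    Site.signedPerm (Equiv.refl (Fin 3)) (Function.update (1 : Fin 3 → ℤˣ) 0 (-1)) p 0 = -p 0 := by
  simp [Site.signedPerm_apply]

/-- The signed coordinate permutation `x ↦ (−x₀, x₁, x₂)` fixes the transverse coordinates. [folklore] -/
theorem signedPerm_mirror_apply_of_ne_zero (p : Site 3) (i : Fin 3) (hi : i ≠ 0) :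
    Site.signedPerm (Equiv.refl (Fin 3)) (Function.update (1 : Fin 3 → ℤˣ) 0 (-1)) p i = p i := by
  simp [Site.signedPerm_apply, Function.update_of_ne hi]

/-- No nearest-neighbour bond of `ℤ³` joins `{x₀ > 0}` to `{x₀ < 0}`: the endpoints of a bond lie both in
the closed upper or both in the closed lower half-space. [folklore] -/
theorem adj_halfSpaces {p q : Site 3} (hpq : (zdGraph 3).Adj p q) :
    (0 ≤ p 0 ∧ 0 ≤ q 0) ∨ (p 0 ≤ 0 ∧ q 0 ≤ 0) := by
  obtain ⟨i, h | h⟩ := (zdGraph_adj_iff p q).1 hpq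
  · have h0 := congrFun h 0
    simp only [Pi.add_apply, Pi.single_apply] at h0
    split_ifs at h0 <;> omega
  · have h0 := congrFun h 0
    simp only [Pi.add_apply, Pi.single_apply] at h0
    split_ifs at h0 <;> omega

/-! ### §B. The half-space mix of two finite configurations and the Markov property -/

/-- Gluing the mix `y ↦ (0 ≤ y₀ ? τ y : τ' y)` agrees with gluing `τ` on the closed upper half-space.
[folklore] -/
theorem glue_mix_of_nonneg {L : ℕ} (τ τ' : ↥(box 3 L) → ℤˣ) {p : Site 3} (hp : 0 ≤ p 0) :
    glue (box 3 L) (fun y => if 0 ≤ (y : Site 3) 0 then τ y else τ' y) BoundaryCondition.plus p =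
      glue (box 3 L) τ BoundaryCondition.plus p := by
  by_cases hpΛ : p ∈ box 3 L
  · rw [glue_apply_of_mem _ _ _ hpΛ, glue_apply_of_mem _ _ _ hpΛ, if_pos hp]
  · rw [glue_apply_of_notMem _ _ _ hpΛ, glue_apply_of_notMem _ _ _ hpΛ]

/-- Gluing the mix agrees with gluing `τ'` on the open lower half-space. [folklore] -/
theorem glue_mix_of_neg {L : ℕ} (τ τ' : ↥(box 3 L) → ℤˣ) {p : Site 3} (hp : p 0 < 0) :
    glue (box 3 L) (fun y => if 0 ≤ (y : Site 3) 0 then τ y else τ' y) BoundaryCondition.plus p =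
      glue (box 3 L) τ' BoundaryCondition.plus p := by
  by_cases hpΛ : p ∈ box 3 L
  · rw [glue_apply_of_mem _ _ _ hpΛ, glue_apply_of_mem _ _ _ hpΛ, if_neg (not_le.2 hp)]
  · rw [glue_apply_of_notMem _ _ _ hpΛ, glue_apply_of_notMem _ _ _ hpΛ]

/-- Two finite configurations with the same layer spins glue to configurations agreeing on the layer.
[folklore] -/
theorem glue_eq_of_layer_eq {L : ℕ} {τ τ' : ↥(box 3 L) → ℤˣ}
    (hk : ∀ y : ↥(box 3 L), (y : Site 3) 0 = 0 → τ' y = τ y) {p : Site 3} (hp : p 0 = 0) :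
    glue (box 3 L) τ BoundaryCondition.plus p = glue (box 3 L) τ' BoundaryCondition.plus p := by
  by_cases hpΛ : p ∈ box 3 L
  · rw [glue_apply_of_mem _ _ _ hpΛ, glue_apply_of_mem _ _ _ hpΛ]
    exact (hk ⟨p, hpΛ⟩ hp).symm
  · rw [glue_apply_of_notMem _ _ _ hpΛ, glue_apply_of_notMem _ _ _ hpΛ]

/-- For two configurations with the same layer spins, gluing the mix agrees with gluing `τ'` on the
closed lower half-space. [folklore] -/
theorem glue_mix_of_nonpos {L : ℕ} {τ τ' : ↥(box 3 L) → ℤˣ}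
    (hk : ∀ y : ↥(box 3 L), (y : Site 3) 0 = 0 → τ' y = τ y) {p : Site 3} (hp : p 0 ≤ 0) :
    glue (box 3 L) (fun y => if 0 ≤ (y : Site 3) 0 then τ y else τ' y) BoundaryCondition.plus p =
      glue (box 3 L) τ' BoundaryCondition.plus p := by
  rcases hp.lt_or_eq with hlt | heq
  · exact glue_mix_of_neg τ τ' hlt
  · rw [glue_mix_of_nonneg τ τ' heq.ge, glue_eq_of_layer_eq hk heq]

/-- **Markov property of the nearest-neighbour Boltzmann weight across the layer.** For two
configurations of `[-L,L]³` with the same layer spins, exchanging their lower halves preserves the sum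
of the two Hamiltonians (plus boundary condition, any field): every bond of `ℰ^b_Λ` lies in a closed
half-space, on which the two mixed configurations restrict to the two original ones (in some order),
and so does every site. [cite: GlimmJaffe1987, §6.1 Remark 'Transfer matrix of statistical physics', pp. 89–90] -/
theorem hamiltonian_mix_add {L : ℕ} (h : ℝ) {τ τ' : ↥(box 3 L) → ℤˣ}
    (hk : ∀ y : ↥(box 3 L), (y : Site 3) 0 = 0 → τ' y = τ y) :
    isingHamiltonian (zdGraph 3) (box 3 L) h BoundaryCondition.plus
        (glue (box 3 L) (fun y => if 0 ≤ (y : Site 3) 0 then τ y else τ' y) BoundaryCondition.plus) +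
      isingHamiltonian (zdGraph 3) (box 3 L) h BoundaryCondition.plus
        (glue (box 3 L) (fun y => if 0 ≤ (y : Site 3) 0 then τ' y else τ y) BoundaryCondition.plus) =
    isingHamiltonian (zdGraph 3) (box 3 L) h BoundaryCondition.plus
        (glue (box 3 L) τ BoundaryCondition.plus) +
      isingHamiltonian (zdGraph 3) (box 3 L) h BoundaryCondition.plus
        (glue (box 3 L) τ' BoundaryCondition.plus) := by
  have hk' : ∀ y : ↥(box 3 L), (y : Site 3) 0 = 0 → τ y = τ' y := fun y hy => (hk y hy).symm
  -- bonds: both endpoints lie in a common closed half-space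
  have hE : ∀ e ∈ interactionEdges (zdGraph 3) (box 3 L) BoundaryCondition.plus,
      bondSpin (glue (box 3 L) (fun y => if 0 ≤ (y : Site 3) 0 then τ y else τ' y)
          BoundaryCondition.plus) e +
        bondSpin (glue (box 3 L) (fun y => if 0 ≤ (y : Site 3) 0 then τ' y else τ y)
          BoundaryCondition.plus) e =
      bondSpin (glue (box 3 L) τ BoundaryCondition.plus) e +
        bondSpin (glue (box 3 L) τ' BoundaryCondition.plus) e := by
    intro e he
    have he' : e ∈ (zdGraph 3).edgeSet := by
      rw [BoundaryCondition.plus, interactionEdges_fixed, mem_edgesTouching_iff] at he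
      exact he.1
    revert he'
    induction e using Sym2.ind with
    | _ p q =>
      intro he'
      rw [SimpleGraph.mem_edgeSet] at he'
      simp only [bondSpin_mk, spinAt]
      rcases adj_halfSpaces he' with ⟨hp, hq⟩ | ⟨hp, hq⟩
      · rw [glue_mix_of_nonneg τ τ' hp, glue_mix_of_nonneg τ τ' hq, glue_mix_of_nonneg τ' τ hp,
          glue_mix_of_nonneg τ' τ hq]
      · rw [glue_mix_of_nonpos hk hp, glue_mix_of_nonpos hk hq, glue_mix_of_nonpos hk' hp,
          glue_mix_of_nonpos hk' hq, add_comm]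
  -- sites (the field term): every site lies in a closed half-space
  have hV : ∀ p ∈ box 3 L,
      spinAt p (glue (box 3 L) (fun y => if 0 ≤ (y : Site 3) 0 then τ y else τ' y)
          BoundaryCondition.plus) +
        spinAt p (glue (box 3 L) (fun y => if 0 ≤ (y : Site 3) 0 then τ' y else τ y)
          BoundaryCondition.plus) =
      spinAt p (glue (box 3 L) τ BoundaryCondition.plus) +
        spinAt p (glue (box 3 L) τ' BoundaryCondition.plus) := by
    intro p _
    simp only [spinAt]
    rcases le_or_gt 0 (p 0) with hp | hp
    · rw [glue_mix_of_nonneg τ τ' hp, glue_mix_of_nonneg τ' τ hp]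
    · rw [glue_mix_of_neg τ τ' hp, glue_mix_of_neg τ' τ hp, add_comm]
  have hE' := Finset.sum_congr rfl hE
  have hV' := Finset.sum_congr rfl hV
  rw [Finset.sum_add_distrib, Finset.sum_add_distrib] at hE' hV'
  simp only [isingHamiltonian]
  linear_combination -hE' - h * hV'

/-- **The Boltzmann weights factorise across the layer**: `w(mix τ τ') · w(mix τ' τ) = w(τ) · w(τ')`
for `τ, τ'` with the same layer spins (from `hamiltonian_mix_add`).
[cite: GlimmJaffe1987, §6.1 Remark 'Transfer matrix of statistical physics', pp. 89–90] -/
theorem weight_mix_mul {L : ℕ} (β h : ℝ) {τ τ' : ↥(box 3 L) → ℤˣ}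
    (hk : ∀ y : ↥(box 3 L), (y : Site 3) 0 = 0 → τ' y = τ y) :
    isingWeight (zdGraph 3) (box 3 L) β h BoundaryCondition.plus
        (fun y => if 0 ≤ (y : Site 3) 0 then τ y else τ' y) *
      isingWeight (zdGraph 3) (box 3 L) β h BoundaryCondition.plus
        (fun y => if 0 ≤ (y : Site 3) 0 then τ' y else τ y) =
    isingWeight (zdGraph 3) (box 3 L) β h BoundaryCondition.plus τ *
      isingWeight (zdGraph 3) (box 3 L) β h BoundaryCondition.plus τ' := by
  simp only [isingWeight, ← Real.exp_add]
  congr 1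
  rw [← mul_add, ← mul_add, hamiltonian_mix_add h hk]

/-- Exchanging the lower halves twice is the identity (the Markov involution on pairs of a fibre).
[folklore] -/
theorem mix_mix {L : ℕ} (τ τ' : ↥(box 3 L) → ℤˣ) :
    (fun y : ↥(box 3 L) =>
        if 0 ≤ (y : Site 3) 0 then (fun y : ↥(box 3 L) => if 0 ≤ (y : Site 3) 0 then τ y else τ' y) y
        else (fun y : ↥(box 3 L) => if 0 ≤ (y : Site 3) 0 then τ' y else τ y) y) = τ := by
  funext y
  by_cases h : 0 ≤ (y : Site 3) 0 <;> simp [h]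

/-- The deep spin `σ_{(n,0,0)}` of the glued mix is that of the upper configuration. [folklore] -/
theorem spinAt_deep_mix (n : ℕ) {L : ℕ} (τ τ' : ↥(box 3 L) → ℤˣ) :
    spinAt (deepSite n)
        (glue (box 3 L) (fun y => if 0 ≤ (y : Site 3) 0 then τ y else τ' y) BoundaryCondition.plus) =
      spinAt (deepSite n) (glue (box 3 L) τ BoundaryCondition.plus) := by
  simp only [spinAt]
  rw [glue_mix_of_nonneg τ τ']
  simp [deepSite]

/-- The mirrored deep spin `σ_{(-n,0,0)}` of the glued mix is that of the lower configuration (same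
layer spins). [folklore] -/
theorem spinAt_negDeep_mix (n : ℕ) {L : ℕ} {τ τ' : ↥(box 3 L) → ℤˣ}
    (hk : ∀ y : ↥(box 3 L), (y : Site 3) 0 = 0 → τ' y = τ y) :
    spinAt (Fin.cons (-(n : ℤ)) 0 : Site 3)
        (glue (box 3 L) (fun y => if 0 ≤ (y : Site 3) 0 then τ y else τ' y) BoundaryCondition.plus) =
      spinAt (Fin.cons (-(n : ℤ)) 0 : Site 3) (glue (box 3 L) τ' BoundaryCondition.plus) := by
  simp only [spinAt]
  rw [glue_mix_of_nonpos hk]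
  simp

/-! ### §C. The mirror on finite configurations of the box -/

/-- The relabelling of finite configurations by a box-preserving mirror fixes the layer spins.
[folklore] -/
theorem comp_mirror_of_layer (θ : Site 3 ≃ Site 3) (hθ0 : ∀ p, θ p 0 = -p 0)
    (hθ1 : ∀ p (i : Fin 3), i ≠ 0 → θ p i = p i) {L : ℕ} (hΛ : ∀ p, p ∈ box 3 L ↔ θ p ∈ box 3 L)
    (τ : ↥(box 3 L) → ℤˣ) (y : ↥(box 3 L)) (hy : (y : Site 3) 0 = 0) :
    (τ ∘ volEquiv θ hΛ) y = τ y := by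
  simp only [Function.comp_apply]
  congr 1
  exact Subtype.ext (mirror_of_layer θ hθ0 hθ1 hy)

/-- The relabelling by a box-preserving mirror is an involution on finite configurations. [folklore] -/
theorem comp_mirror_comp_mirror (θ : Site 3 ≃ Site 3) (hθ0 : ∀ p, θ p 0 = -p 0)
    (hθ1 : ∀ p (i : Fin 3), i ≠ 0 → θ p i = p i) {L : ℕ} (hΛ : ∀ p, p ∈ box 3 L ↔ θ p ∈ box 3 L)
    (τ : ↥(box 3 L) → ℤˣ) : (τ ∘ volEquiv θ hΛ) ∘ volEquiv θ hΛ = τ := by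
  funext y
  simp only [Function.comp_apply]
  congr 1
  exact Subtype.ext (mirror_mirror θ hθ0 hθ1 _)

/-- The Boltzmann weight of `[-L,L]³` (plus boundary condition) is invariant under a box-preserving
automorphism of `ℤ³` (the plus configuration is invariant under every bijection).
[cite: FriedliVelenik2017, Exercise 3.14, p. 115] -/
theorem weight_comp_mirror (θ : Site 3 ≃ Site 3)
    (hadj : ∀ p q, (zdGraph 3).Adj (θ p) (θ q) ↔ (zdGraph 3).Adj p q) {L : ℕ}
    (hΛ : ∀ p, p ∈ box 3 L ↔ θ p ∈ box 3 L) (β h : ℝ) (τ : ↥(box 3 L) → ℤˣ) :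
    isingWeight (zdGraph 3) (box 3 L) β h BoundaryCondition.plus (τ ∘ volEquiv θ hΛ) =
      isingWeight (zdGraph 3) (box 3 L) β h BoundaryCondition.plus τ := by
  rw [isingWeight, isingWeight, glue_comp_volEquiv θ hΛ _ (fun _ => rfl),
    isingHamiltonian_comp (zdGraph 3) θ hadj hΛ]

/-- Under the relabelling by a box-preserving mirror the spin at `(-n,0,0)` becomes the deep spin at
`(n,0,0)`. [folklore] -/
theorem spinAt_negDeep_comp_mirror (θ : Site 3 ≃ Site 3) (hθ0 : ∀ p, θ p 0 = -p 0)
    (hθ1 : ∀ p (i : Fin 3), i ≠ 0 → θ p i = p i) {L : ℕ} (hΛ : ∀ p, p ∈ box 3 L ↔ θ p ∈ box 3 L)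
    (n : ℕ) (τ : ↥(box 3 L) → ℤˣ) :
    spinAt (Fin.cons (-(n : ℤ)) 0 : Site 3) (glue (box 3 L) (τ ∘ volEquiv θ hΛ) BoundaryCondition.plus) =
      spinAt (deepSite n) (glue (box 3 L) τ BoundaryCondition.plus) := by
  rw [glue_comp_volEquiv θ hΛ _ (fun _ => rfl)]
  simp only [spinAt, Function.comp_apply]
  rw [mirror_negDeep θ hθ0 hθ1]

/-! ### §D. The registered bookkeeping theorem: the Markov–mirror structure of the box weights -/

/-- **Registered helper stub `stub_markovSquareMixing` (bookkeeping sub-goal of stub M1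
`stub_markovSquare`).** On the finite configurations `τ : [-L,L]³ → {±1}` there are a MIRROR `Θ`
(relabelling by `x₀ ↦ −x₀`) and a half-space MIX `mix` (upper half and layer from the first, lower half
from the second argument) such that: `Θ` fixes the layer spins, is an involution, preserves the plus
Boltzmann weight and turns `σ_{(−n,0,0)}` into `σ_{(n,0,0)}`; and for `τ, τ'` with the same layer spins,
`mix τ τ'` has those layer spins, `(τ,τ') ↦ (mix τ τ', mix τ' τ)` is an involution, the weights
FACTORISE `w(mix τ τ')w(mix τ' τ) = w(τ)w(τ')` (nearest-neighbour Markov property across the layer),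
and `σ_{(n,0,0)}`, `σ_{(−n,0,0)}` of `mix τ τ'` are those of `τ`, `τ'` respectively.
[cite: GlimmJaffe1987, §6.1 Remark 'Transfer matrix of statistical physics', pp. 89–90] -/
theorem stub_markovSquareMixing :
    ∀ (n L : ℕ) (β h : ℝ),
      ∃ (Θ : (↥(box 3 L) → ℤˣ) → (↥(box 3 L) → ℤˣ))
        (mix : (↥(box 3 L) → ℤˣ) → (↥(box 3 L) → ℤˣ) → (↥(box 3 L) → ℤˣ)),
        (∀ τ, (∀ y : ↥(box 3 L), (y : Site 3) 0 = 0 → Θ τ y = τ y) ∧ Θ (Θ τ) = τ ∧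
          isingWeight (zdGraph 3) (box 3 L) β h BoundaryCondition.plus (Θ τ) =
            isingWeight (zdGraph 3) (box 3 L) β h BoundaryCondition.plus τ ∧
          spinAt (Fin.cons (-(n : ℤ)) 0 : Site 3) (glue (box 3 L) (Θ τ) BoundaryCondition.plus) =
            spinAt (deepSite n) (glue (box 3 L) τ BoundaryCondition.plus)) ∧
        (∀ τ τ', (∀ y : ↥(box 3 L), (y : Site 3) 0 = 0 → τ' y = τ y) →
          (∀ y : ↥(box 3 L), (y : Site 3) 0 = 0 → mix τ τ' y = τ y) ∧
          mix (mix τ τ') (mix τ' τ) = τ ∧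
          isingWeight (zdGraph 3) (box 3 L) β h BoundaryCondition.plus (mix τ τ') *
              isingWeight (zdGraph 3) (box 3 L) β h BoundaryCondition.plus (mix τ' τ) =
            isingWeight (zdGraph 3) (box 3 L) β h BoundaryCondition.plus τ *
              isingWeight (zdGraph 3) (box 3 L) β h BoundaryCondition.plus τ' ∧
          spinAt (deepSite n) (glue (box 3 L) (mix τ τ') BoundaryCondition.plus) =
            spinAt (deepSite n) (glue (box 3 L) τ BoundaryCondition.plus) ∧
          spinAt (Fin.cons (-(n : ℤ)) 0 : Site 3) (glue (box 3 L) (mix τ τ') BoundaryCondition.plus) =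
            spinAt (Fin.cons (-(n : ℤ)) 0 : Site 3) (glue (box 3 L) τ' BoundaryCondition.plus)) := by
  intro n L β h
  have hΛ : ∀ p : Site 3, p ∈ box 3 L ↔
      Site.signedPerm (Equiv.refl (Fin 3)) (Function.update (1 : Fin 3 → ℤˣ) 0 (-1)) p ∈ box 3 L :=
    fun p => (Literature.Probability.Percolation.signedPerm_mem_box_iff _ _).symm
  have hadj : ∀ p q : Site 3,
      (zdGraph 3).Adj (Site.signedPerm (Equiv.refl (Fin 3)) (Function.update (1 : Fin 3 → ℤˣ) 0 (-1)) p)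
          (Site.signedPerm (Equiv.refl (Fin 3)) (Function.update (1 : Fin 3 → ℤˣ) 0 (-1)) q) ↔
        (zdGraph 3).Adj p q :=
    fun p q => (Literature.Probability.Percolation.zdSignedPermIso _ _).map_adj_iff
  refine ⟨fun τ => τ ∘ volEquiv _ hΛ, fun τ τ' y => if 0 ≤ (y : Site 3) 0 then τ y else τ' y,
    fun τ => ⟨comp_mirror_of_layer _ signedPerm_mirror_apply_zero signedPerm_mirror_apply_of_ne_zero hΛ τ,
      comp_mirror_comp_mirror _ signedPerm_mirror_apply_zero signedPerm_mirror_apply_of_ne_zero hΛ τ,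
      weight_comp_mirror _ hadj hΛ β h τ,
      spinAt_negDeep_comp_mirror _ signedPerm_mirror_apply_zero signedPerm_mirror_apply_of_ne_zero
        hΛ n τ⟩,
    fun τ τ' hk => ⟨fun y hy => if_pos hy.ge, mix_mix τ τ', weight_mix_mul β h hk,
      spinAt_deep_mix n τ τ', spinAt_negDeep_mix n hk⟩⟩

end Summit.CriticalPhenomena.Ising3DConformalLimit.Cruxes.GaussianLimitNotScreened.SingleLayerLinearRegression

end
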